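/-
Copyright: cell pub-balaban-gaps (YM BLITZ Y1, track G1), seat g1-p2 GEN 11 (unit `pub-balaban-gaps-g1-p2`).  Row (D4) NODE O, MODEL level:
the PER-CUBE GAUGED COERCIVITY of 59b–66's one-scale covariant operator in the HYPOTHESIS SHAPE `hcoer` of 104
(`D4WalkBlockLocalInverseGaugeEnd.blockWalkExpansion_gaugedAccretive`): conjugated coercivity of `compress (fibD g·covOp(u)·fibD g⁻) □̃` from the
windows on the defects IN THE CUBE'S GAUGE `g` (print's (3.35) ∕ (3.37): `U^{u_□} = e^{iηA}`, `A` small on `□`) — 118's `covOp_gauge` turns the gauged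
compression into the compression of the operator with gauged defects and gauged transporters, to which 114 (any weight) and 117 (the fine ℓ¹
weight, constants free of the scale) apply verbatim.  HONEST FRAMING: model level; the gauge and the windows in it are hypothesis data (107's
`gauge_data_of_reg335Cube_on` is their source from lit-balaban's `Reg335Cube`); 104's GLOBAL margin stays k-dependent on this carrier ((σ));
Bałaban's `Δ^{(k)}(𝐔)` NOT constructed; (D4) instance 0∕1; NOT BetaPertH, NOT continuum, NOT Clay.
-/
import Summits.QuantumFields.BalabanUV.Gaps.D4WalkBlockFormCovOpFineTorus
import Summits.QuantumFields.BalabanUV.Gaps.D4WalkBlockFormGaugeTorus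

/-!
# `Gaps.D4WalkBlockFormGaugedCubeTorus` — per-cube coercivity of the one-scale covariant operator in the cube's gauge (104's `hcoer` shape on
# 59b–66's carrier), k-free constants at the fine ℓ¹ weight (cell pub-balaban-gaps, seat g1-p2 gen 11)

HONEST DEPENDENCY (cell pub-balaban, verbatim): continuum YM on T⁴ ⇐ BetaPertH ∧ nine spine estimates (0/9 proved); BetaPertH ⇐ (D1) ∧ (D4) ∧ CAP+tail.

* **`conjCoercive_compress_gauged_covOp`** — 114 read through 118: for a site gauge `gg⁻ = 1`, windows on the GAUGED defects
  `W⁺ᵍ_μ(u,x) = g(x)(1 + W⁺_μ(u,x))g⁻(x + e_μ) − 1`, `W⁻ᵍ_μ(u,x) = g(x)(1 + W⁻_μ(u,x))g⁻(x − e_μ) − 1` and the averaging budget of the GAUGED projector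
  on the ball, any admissible weight: `M·‖z‖² ≤ Re conjForm (compress (fibD g·covOp(u)·fibD g⁻) S) κ ρ z`;
* **`conjCoercive_compress_gauged_covOp_fine`** — 117 read through 118: the same at the fine ℓ¹ weight `η·d₁(·, j)` with the transporter letters of the
  GAUGED block-contour transporters `U(Γ_{y,x})g⁻(x)`, `g(x)U(Γ_{y,x})⁻¹`; constants free of the scale.
WHAT IT IS NOT.  104's END on this carrier (its global margin `hq` with `C_K`, `c_s` is k-dependent here per (σ)); the windows from `Reg335Cube` (107 + 66's
letters); (D4) instance 0∕1; words of row (D4) UNCHANGED (`ExistsUniformAcrossSmall 𝓣_Bałaban α Rσ₀ θ₀` + `TermDomination`, OBJECT level).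

References (method only): T. Bałaban, Comm. Math. Phys. **99** (1985) 389–434 [B9], (3.35)–(3.37) p. 396, p. 398, (3.50)–(3.60) pp. 400–402, Cor. 3.6
p. 408, p. 409.
-/

noncomputable section

namespace Summit.QuantumFields.BalabanUV.Gaps.D4WalkBlockFormGaugedCubeTorus

open Metric Set Finset Complex Matrix
open scoped BigOperators Matrix ComplexConjugate
open Literature.MathematicalPhysics.QuantumFieldTheory.Balaban1983to89
open Literature.MathematicalPhysics.QuantumFieldTheory.Balaban1983to89.B5Prop11Lower (nsq)
open Literature.MathematicalPhysics.QuantumFieldTheory.Balaban1983to89.B6Prop22OneScaleTorus (T1)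
open Summit.QuantumFields.BalabanUV.Beta.UnitLatticeLocalInverse (compress)
open Summit.QuantumFields.BalabanUV.Beta.AccretiveCombesThomas (conjForm)
open Summit.QuantumFields.BalabanUV.Gaps.D4WalkBlockShiftAlgebra (fibD)
open Summit.QuantumFields.BalabanUV.Gaps.D4WalkBlockCovariantPropagator (Pf covOp)
open Summit.QuantumFields.BalabanUV.Gaps.D4WalkBlockCovariantBlockAveraging (PU)
open Summit.QuantumFields.BalabanUV.Gaps.D4WalkBlockLocalInverse (cRow cCol)
open Summit.QuantumFields.BalabanUV.Gaps.D4WalkBlockFormCovOpTorus (conjCoercive_compress_covOp)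
open Summit.QuantumFields.BalabanUV.Gaps.D4WalkBlockFormCovOpFineTorus (conjCoercive_compress_covOp_fine)
open Summit.QuantumFields.BalabanUV.Gaps.D4WalkBlockFormGaugeTorus (covOp_gauge)

variable {P : Params} {F : Type} [Fintype F] [DecidableEq F]
variable {E : Type*} [NormedAddCommGroup E] [NormedSpace ℂ E]
variable {Wp Wm : Fin P.d → E → Site P 0 → Matrix F F ℂ} {Ug Ugi : E → Site P 0 → Matrix F F ℂ} {a msq : ℝ} {g gi : Site P 0 → Matrix F F ℂ}

omit [NormedSpace ℂ E] in
/-- **PER-CUBE GAUGED COERCIVITY (104's `hcoer` shape), any admissible weight** — 114 through 118's `covOp_gauge`. [cite: Balaban1985BackgroundPropagators, (3.35)–(3.37) p.396, Cor. 3.6 p.408, p.409] -/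
theorem conjCoercive_compress_gauged_covOp (hg : ∀ x, g x * gi x = 1) (ha : 0 < a) (hmsq : 0 ≤ msq) (hK : 1 ≤ P.K)
    (hα : 0 ≤ B1RG242Torus.α P a P.K) {ℓ ℓB : ℝ} (hℓ : 0 ≤ ℓ)
    (ρ : Site P 0 × F → ℝ) (hρ : ∀ (p : Site P 0 × F) (μ : Fin P.d), |ρ p - ρ (Site.shift p.1 μ, p.2)| ≤ ℓ)
    (hρB : ∀ (x x' : Site P 0) (b : F), Site.proj P.K (B1RG242Torus.lvl P P.K) x' = Site.proj P.K (B1RG242Torus.lvl P P.K) x →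
      |ρ (x, b) - ρ (x', b)| ≤ ℓB)
    (hρF : ∀ (x : Site P 0) (b b' : F), ρ (x, b) = ρ (x, b'))
    (S : Finset (Site P 0 × F)) (hS : ∀ p ∈ S, ∀ b : F, (p.1, b) ∈ S) {R β β₀ γr γc t : ℝ} (κ : ℝ)
    (hWp : ∀ μ, ∀ u ∈ ball (0 : E) R, ∀ x b, ∑ b', ‖(g x * (1 + Wp μ u x) * gi (Site.shift x μ) - 1) b b'‖ ≤ P.eps * β ∧
      ∑ b', ‖(g x * (1 + Wp μ u x) * gi (Site.shift x μ) - 1) b' b‖ ≤ P.eps * β)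
    (hWm : ∀ μ, ∀ u ∈ ball (0 : E) R, ∀ x b, ∑ b', ‖(g x * (1 + Wm μ u x) * gi (Site.unshift x μ) - 1) b b'‖ ≤ P.eps * β ∧
      ∑ b', ‖(g x * (1 + Wm μ u x) * gi (Site.unshift x μ) - 1) b' b‖ ≤ P.eps * β)
    (hW0 : ∀ u ∈ ball (0 : E) R, ∀ x b,
      ∑ b', ‖(∑ μ, ((g x * (1 + Wp μ u x) * gi (Site.shift x μ) - 1) + (g x * (1 + Wm μ u x) * gi (Site.unshift x μ) - 1))) b b'‖ ≤ P.eps ^ 2 * β₀ ∧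
      ∑ b', ‖(∑ μ, ((g x * (1 + Wp μ u x) * gi (Site.shift x μ) - 1) + (g x * (1 + Wm μ u x) * gi (Site.unshift x μ) - 1))) b' b‖ ≤ P.eps ^ 2 * β₀)
    (hAr : ∀ u ∈ ball (0 : E) R, ∀ e : S,
      cRow (compress (PU P F (fun u x => Ug u x * gi x) (fun u x => g x * Ugi u x) u - Pf P F) S) κ (fun e : S => ρ e) e ≤ γr)
    (hAc : ∀ u ∈ ball (0 : E) R, ∀ e : S,
      cCol (compress (PU P F (fun u x => Ug u x * gi x) (fun u x => g x * Ugi u x) u - Pf P F) S) κ (fun e : S => ρ e) e ≤ γc)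
    (hβ : 0 ≤ β) (ht : 0 < t) (htγ : t * β * ((1 + Real.exp (2 * (|κ| * ℓ))) * 2) ≤ 2) :
    ∀ u ∈ ball (0 : E) R, ∀ z : S → ℂ,
      ((1 - t * β * ((1 + Real.exp (2 * (|κ| * ℓ))) * 2) / 2)
          * (min 8 (a * (1 - (((P.L : ℝ)) ^ 2)⁻¹)) - (0 + 2 * P.d * (P.eps⁻¹ ^ 2 * (Real.cosh (|κ| * ℓ) - 1))
              + B1RG242Torus.α P a P.K * (Real.cosh (|κ| * ℓB) - 1)))
        - ((β₀ + B1RG242Torus.α P a P.K * γr) + (β₀ + B1RG242Torus.α P a P.K * γc)) / 2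
        - (∑ _ι : Fin P.d ⊕ Fin P.d, β) / (2 * t)
        - t * β * ((1 + Real.exp (2 * (|κ| * ℓ))) * (2 * (B1RG242Torus.α P a P.K * Real.exp (|κ| * ℓB))
            + 4 * P.d * (P.eps⁻¹ * (Real.exp (|κ| * ℓ) - 1)) ^ 2)) / 2) * nsq z
      ≤ (conjForm (compress (fibD (Site P 0) F g * covOp P F Wp Wm (PU P F Ug Ugi) a msq u * fibD (Site P 0) F gi) S) κ (fun e : S => ρ e) z).re := by
  intro u hu z
  rw [covOp_gauge g gi Wp Wm Ug Ugi a msq hg u]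
  exact conjCoercive_compress_covOp ha hmsq hK hα hℓ ρ hρ hρB hρF S hS κ hWp hWm hW0 hAr hAc hβ ht htγ u hu z

omit [NormedSpace ℂ E] in
/-- **PER-CUBE GAUGED COERCIVITY AT THE FINE ℓ¹ WEIGHT, CONSTANTS FREE OF THE SCALE** — 117 through 118's `covOp_gauge`: windows on the gauged defects and
row ∕ column letters `α_g` of the gauged block-contour transporters. [cite: Balaban1985BackgroundPropagators, (3.35)–(3.37) p.396, Cor. 3.6 p.408, p.409] -/
theorem conjCoercive_compress_gauged_covOp_fine (hg : ∀ x, g x * gi x = 1) (ha : 0 < a) (hmsq : 0 ≤ msq) (hK : 1 ≤ P.K)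
    (S : Finset (Site P 0 × F)) (hS : ∀ p ∈ S, ∀ b : F, (p.1, b) ∈ S) {R β β₀ αg t : ℝ} (κ : ℝ)
    (hWp : ∀ μ, ∀ u ∈ ball (0 : E) R, ∀ x b, ∑ b', ‖(g x * (1 + Wp μ u x) * gi (Site.shift x μ) - 1) b b'‖ ≤ P.eps * β ∧
      ∑ b', ‖(g x * (1 + Wp μ u x) * gi (Site.shift x μ) - 1) b' b‖ ≤ P.eps * β)
    (hWm : ∀ μ, ∀ u ∈ ball (0 : E) R, ∀ x b, ∑ b', ‖(g x * (1 + Wm μ u x) * gi (Site.unshift x μ) - 1) b b'‖ ≤ P.eps * β ∧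
      ∑ b', ‖(g x * (1 + Wm μ u x) * gi (Site.unshift x μ) - 1) b' b‖ ≤ P.eps * β)
    (hW0 : ∀ u ∈ ball (0 : E) R, ∀ x b,
      ∑ b', ‖(∑ μ, ((g x * (1 + Wp μ u x) * gi (Site.shift x μ) - 1) + (g x * (1 + Wm μ u x) * gi (Site.unshift x μ) - 1))) b b'‖ ≤ P.eps ^ 2 * β₀ ∧
      ∑ b', ‖(∑ μ, ((g x * (1 + Wp μ u x) * gi (Site.shift x μ) - 1) + (g x * (1 + Wm μ u x) * gi (Site.unshift x μ) - 1))) b' b‖ ≤ P.eps ^ 2 * β₀)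
    (hαg : 0 ≤ αg)
    (hUg : ∀ u ∈ ball (0 : E) R, ∀ x c, ∑ b, ‖(Ug u x * gi x - 1) c b‖ ≤ αg ∧ ∑ b, ‖(Ug u x * gi x - 1) b c‖ ≤ αg)
    (hUgi : ∀ u ∈ ball (0 : E) R, ∀ x c, ∑ b, ‖(g x * Ugi u x - 1) c b‖ ≤ αg ∧ ∑ b, ‖(g x * Ugi u x - 1) b c‖ ≤ αg)
    (hβ : 0 ≤ β) (ht : 0 < t) (htγ : t * β * ((1 + Real.exp (2 * (|κ| * P.eps))) * 2) ≤ 2) (j : Site P 0) :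
    ∀ u ∈ ball (0 : E) R, ∀ z : S → ℂ,
      ((1 - t * β * ((1 + Real.exp (2 * (|κ| * P.eps))) * 2) / 2)
          * (min 8 (a * (1 - (((P.L : ℝ)) ^ 2)⁻¹)) - (0 + 2 * P.d * (P.eps⁻¹ ^ 2 * (Real.cosh (|κ| * P.eps) - 1))
              + B1RG242Torus.α P a P.K * (Real.cosh (|κ| * (2 * P.d)) - 1)))
        - ((β₀ + B1RG242Torus.α P a P.K * (Real.exp (|κ| * (2 * P.d)) * (2 * αg + αg ^ 2)))
            + (β₀ + B1RG242Torus.α P a P.K * (Real.exp (|κ| * (2 * P.d)) * (2 * αg + αg ^ 2)))) / 2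
        - (∑ _ι : Fin P.d ⊕ Fin P.d, β) / (2 * t)
        - t * β * ((1 + Real.exp (2 * (|κ| * P.eps))) * (2 * (B1RG242Torus.α P a P.K * Real.exp (|κ| * (2 * P.d)))
            + 4 * P.d * (P.eps⁻¹ * (Real.exp (|κ| * P.eps) - 1)) ^ 2)) / 2) * nsq z
      ≤ (conjForm (compress (fibD (Site P 0) F g * covOp P F Wp Wm (PU P F Ug Ugi) a msq u * fibD (Site P 0) F gi) S) κ
          (fun e : S => P.eps * T1 P 0 (e : Site P 0 × F).1 j) z).re := by
  intro u hu z
  rw [covOp_gauge g gi Wp Wm Ug Ugi a msq hg u]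
  exact conjCoercive_compress_covOp_fine ha hmsq hK S hS κ hWp hWm hW0 hαg hUg hUgi hβ ht htγ j u hu z

end Summit.QuantumFields.BalabanUV.Gaps.D4WalkBlockFormGaugedCubeTorus

end
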